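import Summits.PneNP.PneNP.Theorems.SoloBlindStreamingSimulation
import Literature.Computability.Complexity.Williams2014AccWitnesses
import HarnessLib

/-!
# Solo (blind) — THEOREM E: `P` is exactly polynomial uniform streaming; the summit is itself a
uniform streaming lower bound

In the uniform one-pass streaming model `USTREAM S T` of McKay–Murray–Williams (one `TM2` update
machine and one report machine, empty initial state; tree file
`Literature/…/McKayMurrayWilliams2019/UniformStreaming.lean`) we prove the converse of
`USTREAM_subset_P` (THEOREM D): every language in `P` is decided by the BUFFERING streaming
algorithm (state = the prefix read so far, report = run the polynomial-time decider on the buffer),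
with space `N` and polynomial update / report time. Hence

* `P_eq_iUnion_USTREAM : Classes.P = ⋃ k, USTREAM (fun N => N ^ k + k) (fun N => N ^ k + k)`;
* `pneNP_iff_SAT_not_mem_USTREAM :
    PneNP ↔ ∀ k, SAT ∉ USTREAM (fun N => N ^ k + k) (fun N => N ^ k + k)`.

READING (for the accompanying document "what a proof of `P ≠ NP` must do"). The summit and the
McKay–Murray–Williams magnification hypothesis `StreamingLowerBound s`
(`= ∀ c, MCSPSize s ∉ USTREAM (s (log₂ N) ^ c + c) (s (log₂ N) ^ c + c)`) are lower bounds
in ONE typed model and differ only in the language and the resource scale: `SAT` at scale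
`poly N` (this file: equivalent to `P ≠ NP`) versus the sparse language `MCSP[s]` at scale
`poly (s (log₂ N))` (THEOREMS B/C: sufficient for `P ≠ NP`). No new mathematics: the content is the folklore
observation that a one-pass algorithm with polynomial resources is a polynomial-time algorithm and
conversely, made precise for the tree's `TM2` model.

[cite: McKayMurrayWilliams2019, §2 (Streaming Algorithms); AroraBarak2009, Def. 1.13]
-/

namespace Summit.PneNP.PneNP.Theorems.SoloBlind

open Computability Polynomial
open Literature.Computability.Complexity
open Literature.Computability.Complexity.CodeFP (natE unE bitE pairE strE pairE_apply
  length_natE_le)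
open Literature.Computability.MetaComplexity
open Literature.Computability.MetaComplexity.McKayMurrayWilliams2019

namespace UBuf

/-- The BUFFERING streaming algorithm of a language `L`: empty initial state, the state is the
prefix read so far, acceptance is membership of the buffered input. [folklore] -/
noncomputable def bufferAlg (L : Language Bool) : StreamingAlgorithm where
  init := fun _ => []
  update := fun _ σ b => σ ++ [b]
  accept := fun _ σ => L.boolIndicator σ

/-- The buffering algorithm's state is the prefix read. [folklore] -/
theorem reach_bufferAlg (L : Language Bool) (N : ℕ) (x : List Bool) :
    reach (bufferAlg L) N x = x := by
  induction x using List.reverseRecOn with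
  | nil => simp [bufferAlg]
  | append_singleton x b ih => rw [reach_append_singleton, ih]; rfl

/-- The buffering algorithm's final state is the input. [folklore] -/
theorem finalState_bufferAlg (L : Language Bool) (x : List Bool) :
    (bufferAlg L).finalState x = x := by
  rw [finalState_eq_reach, reach_bufferAlg]

/-- The buffering algorithm decides `L`. [folklore] -/
theorem decides_bufferAlg (L : Language Bool) : (bufferAlg L).Decides L := fun x => by
  rw [StreamingAlgorithm.Accepts, finalState_bufferAlg]
  show L.boolIndicator x = true ↔ x ∈ L
  rw [← Set.mem_iff_boolIndicator]
  exact Iff.rfl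

/-- The buffering algorithm runs in space `N`. [folklore] -/
theorem runsInSpace_bufferAlg (L : Language Bool) :
    RunsInSpace (bufferAlg L) fun N => N := fun N x hx => by
  rw [reach_bufferAlg]; exact hx

/-- The update map `⟨N, σ, b⟩ ↦ σ ++ [b]` on codes. [folklore] -/
theorem cf_bufferUpdate : CodeFP CStream.uE strE (fun u : CStream.UIn => u.2.1 ++ [u.2.2]) := by
  have hsing : CodeFP bitE strE (fun b : Bool => [b]) :=
    ⟨_root_.id, PolyTimeComputable.id _, fun _ => rfl⟩
  exact ((CodeFP.strAppend.comp (((CodeFP.fst _ _).comp (CodeFP.snd _ _)).pair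
    (hsing.comp ((CodeFP.snd _ _).comp (CodeFP.snd _ _))))) :)

/-- The buffering algorithm has polynomial uniform update time. [folklore] -/
theorem hasUniformUpdateTime_bufferAlg (L : Language Bool) :
    ∃ p : Polynomial ℕ, HasUniformUpdateTime (bufferAlg L) fun N => p.eval N := by
  obtain ⟨p, M, hM⟩ := cf_bufferUpdate.polyTimeComputable
  refine ⟨p.comp (4 * X + 5), M, fun N x b hx => ?_⟩
  rw [reach_bufferAlg, reach_bufferAlg]
  have h : M.OutputsWithin (boolPair (encodeNat N) (boolPair x [b])) (x ++ [b])
      (p.eval (CStream.uE (N, x, b)).length) := hM (N, x, b)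
  refine h.mono ?_
  show _ ≤ (p.comp (4 * X + 5)).eval N
  have e : (p.comp (4 * X + 5)).eval N = p.eval (4 * N + 5) := by
    simp only [eval_comp, eval_add, eval_mul, eval_X, eval_ofNat]
  rw [e, CStream.length_uE]
  exact TM2Iter.eval_mono p (by have := length_natE_le N; omega)

/-- The buffering algorithm of a language in `P` has polynomial uniform report time: project the
buffer out of `⟨bin N, buffer⟩` and run the polynomial-time decider. [folklore] -/
theorem hasUniformReportTime_bufferAlg {L : Language Bool} (hL : L ∈ Classes.P) :
    ∃ p : Polynomial ℕ, HasUniformReportTime (bufferAlg L) fun N => p.eval N := by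
  obtain ⟨p, M, hM⟩ := polyTimeDecidable_iff.1 ((mem_P_iff_holds (L := L)).1 hL)
  obtain ⟨ps, Ms, hs⟩ := (CodeFP.snd natE strE).polyTimeComputable
  refine ⟨p + ps.comp (3 * X + 2), Ms.comp M, fun x => ?_⟩
  rw [finalState_bufferAlg]
  have H1 : Ms.OutputsWithin (boolPair (encodeNat x.length) x) x
      (ps.eval (boolPair (encodeNat x.length) x).length) := hs (x.length, x)
  have H2 : M.OutputsWithin x [L.boolIndicator x] (p.eval x.length) := by
    have h := hM x
    have e : encodeBool (L.boolIndicator x) = [L.boolIndicator x] := by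
      cases L.boolIndicator x <;> rfl
    rw [e] at h
    exact h
  refine (Turing.TM2ComputableAux.comp_outputsWithin _ _ H1 H2).mono ?_
  show p.eval x.length + ps.eval (boolPair (encodeNat x.length) x).length
    ≤ (p + ps.comp (3 * X + 2)).eval x.length
  have e : (p + ps.comp (3 * X + 2)).eval x.length
      = p.eval x.length + ps.eval (3 * x.length + 2) := by
    simp only [eval_add, eval_comp, eval_mul, eval_X, eval_ofNat]
  rw [e]
  have hlen : (boolPair (encodeNat x.length) x).length ≤ 3 * x.length + 2 := by
    rw [length_boolPair]
    have := length_natE_le x.length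
    have : (natE x.length).length = (encodeNat x.length).length := rfl
    omega
  have h1 := TM2Iter.eval_mono ps hlen
  omega

end UBuf

/-! ### `P ⊆ ⋃ₖ USTREAM (N^k + k) (N^k + k)` and the equality -/

/-- **Every language in `P` is in polynomial uniform streaming** (buffer the input, decide at the
end). [cite: McKayMurrayWilliams2019, §2 (Streaming Algorithms); AroraBarak2009, Def. 1.13] -/
theorem exists_mem_USTREAM_of_mem_P {L : Language Bool} (hL : L ∈ Classes.P) :
    ∃ k : ℕ, L ∈ USTREAM (fun N => N ^ k + k) (fun N => N ^ k + k) := by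
  obtain ⟨pu, hu⟩ := UBuf.hasUniformUpdateTime_bufferAlg L
  obtain ⟨pr, hr⟩ := UBuf.hasUniformReportTime_bufferAlg hL
  obtain ⟨e, he⟩ := exists_eval_le_pow_add_self (pu + pr)
  have hmem : L ∈ USTREAM (fun N => N) (fun N => (pu + pr).eval N) := by
    refine ⟨UBuf.bufferAlg L, fun _ => rfl, UBuf.runsInSpace_bufferAlg L, ?_, ?_,
      UBuf.decides_bufferAlg L⟩
    · obtain ⟨M, hM⟩ := hu
      exact ⟨M, fun N x b hx => (hM N x b hx).mono (by simp only [eval_add]; omega)⟩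
    · obtain ⟨M, hM⟩ := hr
      exact ⟨M, fun x => (hM x).mono (by simp only [eval_add]; omega)⟩
  refine ⟨e + 1, USTREAM_mono (fun N => ?_) (fun N => ?_) hmem⟩
  · show N ≤ N ^ (e + 1) + (e + 1)
    have : N ≤ N ^ (e + 1) := Nat.le_self_pow (Nat.succ_ne_zero e) N
    omega
  · show (pu + pr).eval N ≤ N ^ (e + 1) + (e + 1)
    have h1 := he N
    have h2 : N ^ e ≤ N ^ (e + 1) + 1 := by
      rcases Nat.eq_zero_or_pos N with rfl | hN
      · cases e <;> simp
      · exact (Nat.pow_le_pow_right hN (Nat.le_succ e)).trans (Nat.le_succ _)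
    omega

/-- **THEOREM E. `P` is exactly polynomial uniform streaming:**
`P = ⋃ₖ USTREAM (N^k + k) (N^k + k)`.
[cite: McKayMurrayWilliams2019, §2 (Streaming Algorithms); AroraBarak2009, Def. 1.13] -/
theorem P_eq_iUnion_USTREAM :
    Classes.P = ⋃ k : ℕ, USTREAM (fun N => N ^ k + k) (fun N => N ^ k + k) := by
  ext L
  simp only [Set.mem_iUnion]
  exact ⟨exists_mem_USTREAM_of_mem_P,
    fun ⟨k, hk⟩ => USTREAM_subset_P (k := k) (fun _ => le_rfl) (fun _ => le_rfl) hk⟩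

/-- **The summit as a uniform streaming lower bound:** `P ≠ NP` holds iff `SAT` has no uniform
one-pass streaming algorithm with polynomial space and polynomial update / report time — the same
typed model in which the McKay–Murray–Williams hypothesis asks for `MCSP[s] ∉ USTREAM` at the
exponentially smaller scale `poly (s (log₂ N))`.
[cite: McKayMurrayWilliams2019, Theorem 1.3 and §2; AroraBarak2009, Thm. 2.10 (Cook–Levin)] -/
theorem pneNP_iff_SAT_not_mem_USTREAM :
    PneNP ↔ ∀ k : ℕ, SAT ∉ USTREAM (fun N => N ^ k + k) (fun N => N ^ k + k) := by
  rw [pneNP_iff_SAT_not_mem_P]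
  constructor
  · intro h k hk
    exact h (USTREAM_subset_P (k := k) (fun _ => le_rfl) (fun _ => le_rfl) hk)
  · intro h hP
    obtain ⟨k, hk⟩ := exists_mem_USTREAM_of_mem_P hP
    exact h k hk

/-- The two streaming statements side by side: the magnification hypothesis for a
time-constructible `s` IMPLIES the summit's streaming form.
[cite: McKayMurrayWilliams2019, Theorem 1.3] -/
theorem SAT_not_mem_USTREAM_of_streamingLowerBound {s : ℕ → ℕ} (hsT : IsTimeConstructible s)
    (hlb : StreamingLowerBound s) (k : ℕ) :
    SAT ∉ USTREAM (fun N => N ^ k + k) (fun N => N ^ k + k) :=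
  pneNP_iff_SAT_not_mem_USTREAM.1 (pneNP_of_streamingLowerBound_tc hsT hlb) k

end Summit.PneNP.PneNP.Theorems.SoloBlind
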